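import Summits.ResolutionOfSingularities.ResolutionOfSingularities.Theorems.ChainW52TargetsF7BetaRP
import HarnessLib

/-!
# Crux `PatchingRelPerfect` (stmt-ResolutionOfSingularities-16161), chain W5.2 — F7(β) (β-AX) X3 C-I (M0) part 2:
# THE BOOKKEEPING CLAUSE OF THE POLE ATLAS — «N-DOMINATION» (virtual form), definition of record

[OURS · L1 W5.2 · res-L1-w52-plan-1 RULING G12-23 (1) (hand res-L1-w52-lead-1 g6, (M0) part 2 owner); design res-L1-w52-idea-1 WORD P
(n3) 2026-08-27T19:39:05Z «P IS ONE CLAUSE, N-DOMINATION»; virtual / positional / prefix form = res-L1-w52-lead-1 RESHAPE 19:58Z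
(repeated carrier positions, vacuous initial validity).]  Replaces the role of NO printed item; NOT a statement of the manuscript under
review (AI-written; AI review weaker than expert review; counted 0).

For a multi-host state `S` (`…DepthMultiHostFormat`) with a cylinder structure `cyl` (`…DepthMultiHostCyl`), `NDominates S cyl` says that
`K = S.K` contains a VIRTUAL PURE SUMMAND `⊤ · monomialIdeal 𝓝` — an exponent list `𝓝` on the member family `S.𝓔` with
`monomialIdeal 𝓝 ≤ S.K` — whose exponents at the CARRIER positions (a prefix of `S.𝓔` of some length `n₀`, every entry of which is
`cyl.j.ker`) total at most `2`, and whose exponent at every later position `j` is DOMINATED, `n_j ≤ (exps i)_j`, by the exponent of every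
summand `i` whose host has order `≥ 2` (`(host i)_x ≤ 𝔪_x²`) at some point `x` of the member `S.𝓔[j]`.  For the honest presentation of the
T0 output (`K = (q^*P_j)_j + 𝓘_E²`) `𝓝` is the exponent list of the pure N-summand `(⊤, 𝓘_E²)`; the virtual form is `AtlasInitial`-valid for
EVERY generation-1 presentation (`𝓘_Z² ≤ K` from `InitialShape`) and step-stable under the v7 cylinder step given X-side equimultiplicity
(`…DepthPhaseCReachNDom`).  Its pointwise corollaries at points off the carrier (res-L1-w52-stub-2): the member hit (M0)
(`…DepthPhaseCReachMemberHit`), LEMMA V, and the swallowing of order-`≥ 2` host terms by a member monomial inside `K♭_x`.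

## References
* J. Kollár, *Lectures on Resolution of Singularities* (2007), (3.111) Steps 1–3. [Kollar2007]
* E. Bierstone, D. Grigoriev, P. Milman, J. Włodarczyk, arXiv:1206.3090, Def. 3.1.3, §4 Step 2b. [BierstoneGrigorievMilmanWlodarczyk2011]
-/

-- `Summit.<Summit>.<Sub>.Theorems` with `Sub = Summit` (single-conjunct summit, D-0017)
set_option linter.dupNamespace false

noncomputable section

open CategoryTheory AlgebraicGeometry TopologicalSpace IsLocalRing
open Literature.AlgebraicGeometry.Resolution Scheme.IdealSheafData

namespace Summit.ResolutionOfSingularities.ResolutionOfSingularities.Theorems.ChainW52F7BetaRP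

universe u

open DepthMultiHost

/-- [OURS · L1 W5.2 · X3 C-I (M0)] **N-DOMINATION (virtual form).** `K` contains a virtual pure summand `⊤ · monomialIdeal 𝓝` (`𝓝` an
exponent list on `S.𝓔`) with: a prefix of `S.𝓔` of length `n₀` consisting of carrier entries `cyl.j.ker` on which the exponents of `𝓝` total
`≤ 2`, and, at every later position `j` and every point `x ∈ Supp S.𝓔[j]` where the host of summand `i` has order `≥ 2`,
`n_j ≤ S.expAt i j`. [cite: Kollar2007, (3.111) Step 3] [cite: BierstoneGrigorievMilmanWlodarczyk2011, §4 Step 2b] -/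
def NDominates ⦃X : Scheme.{u}⦄ (S : MultiHostState X) (cyl : CylState S) : Prop :=
  ∃ (n₀ : ℕ) (𝓝 : List (X.IdealSheafData × ℕ)),
    boundaryOf 𝓝 = S.𝓔 ∧ monomialIdeal 𝓝 ≤ S.K ∧
    (∀ j < n₀, S.𝓔[j]? = some cyl.j.ker) ∧
    ((𝓝.map Prod.snd).take n₀).sum ≤ 2 ∧
    ∀ (i : Fin S.n) (x : X), stalkIdeal (S.host i) x ≤ (maximalIdeal (X.presheaf.stalk x)) ^ 2 →
      ∀ j, n₀ ≤ j → ∀ T, S.𝓔[j]? = some T → x ∈ (T.support : Set X) →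
        (𝓝.map Prod.snd).getD j 0 ≤ S.expAt i j

end Summit.ResolutionOfSingularities.ResolutionOfSingularities.Theorems.ChainW52F7BetaRP

end
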